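import Literature.Analysis.FluidPDE.BrueDeLellisAnomalousDissipation
import Literature.Analysis.FluidPDE.CheskidovGluedCalculus
import Literature.Analysis.FluidPDE.DEIJShearStage
import HarnessLib

/-!
# Regularity bookkeeping for the DEIJ velocity field: Hölder norms of shear drifts, continuity
# in `C^{0,r}` on `[0,T)`, and an `L¹_t C^{0,r}_x` criterion

Proof-support file (everything proved; no named facts) for the regularity clauses of
`Literature.Analysis.FluidPDE.deij_anomalous_dissipation_eventually` /
`Literature.Analysis.FluidPDE.deij_anomalous_dissipation` (`TurbPassiveScalar`; Drivas–Elgindi–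
Iyer–Jeong, ARMA 243 (2022), Thm. 2): the velocity field there is a succession of shear drifts
`DEIJ.drift p q φ ȧ = (ȧ φ(x_q)) e_p` (`DEIJShearStage`), jointly smooth on `[0,T) × T^d`
(singular only at `t = T`), and must be shown to lie in
`FunctionSpaces.ContinuousInHolderOn (Ico 0 T) α` and `FunctionSpaces.MemLpHolder 1 α · (Ioo 0 T)`
([cite: DrivasEtAl2022, §3.3]: `|u|_{L¹([0,1];C^{α'})} ≲ ∑ⱼ tⱼ Nⱼ^{α'} < ∞`).

* `Torus.DEIJ.partialDeriv_drift`, `Torus.DEIJ.norm_partialDeriv_drift_le` — the spatial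
  derivatives of a shear drift: `∂ᵢ drift = δ_{iq} ȧ φ'(x_q) e_p`, `‖∂ᵢ drift‖ ≤ |ȧ| sup|φ'|`;
* `Torus.DEIJ.eBoundedHolderNorm_drift_le` — **the `C^{0,r}` norm of a shear drift by
  interpolation**: `‖drift‖_{C^{0,r}} ≤ |ȧ|A + (√d d |ȧ|B)^r (2|ȧ|A)^{1-r}` when `|φ| ≤ A`,
  `|φ'| ≤ B` (`Gluing.eBoundedHolderNorm_le_interp`), i.e. `≲ |ȧ| A^{1-r} B^r`: for the stage
  profile `c S_ε(N· + ϑ)` (`A = |c|`, `B = |c|N`) this is the `tⱼ Nⱼ^{α}`-type bound of the source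
  (`Torus.DEIJ.eBoundedHolderNorm_drift_stageProfile_le`, `Torus.DEIJ.memBoundedHolder_drift`);
* `Torus.DEIJ.continuousInHolderOn_Ico_of_isSmoothSpaceTimeOn` — the half-open version of
  `BrueDeLellis2023.continuousInHolderOn_of_isSmoothSpaceTimeOn` (there on compact `[a,b]`):
  continuity in the `C^{0,r}` norm is local, and near every `t₀ < T` the set `[0,T)` agrees with
  a compact `[0,b]`, `t₀ < b < T` (`nhdsWithin_le_of_mem`);
* `Torus.DEIJ.memLpHolder_one_of_bound` — `u ∈ L¹_t C^{0,r}_x` on a time set `S` as soon as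
  every slice `u t`, `t ∈ S`, is in `C^{0,r}_b` with `‖u t‖_{C^{0,r}} ≤ h t` for an `h` with
  `‖h‖_{L¹(S)} < ∞`; no measurability of `t ↦ ‖u t‖_{C^{0,r}}` is needed (the `L¹` functional is
  a lower integral, monotone under a.e. bounds, `eLpNorm_mono_ae_real`) — the form in which the
  stagewise bounds `∑ⱼ tⱼ Nⱼ^α < ∞` are fed in.

## References

* T. D. Drivas, T. M. Elgindi, G. Iyer, I.-J. Jeong, *Anomalous dissipation in passive scalar
  transport*, Arch. Ration. Mech. Anal. 243 (2022) (arXiv:1911.03271), Thm. 2 and §3.3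
  (`u ∈ C^∞([0,T) × T^d) ∩ L¹([0,T]; C^α)`). [`DrivasEtAl2022`]
-/

noncomputable section

open MeasureTheory Set Function Filter Topology UnitAddTorus
open scoped ENNReal NNReal
open Literature.Analysis.FunctionSpaces
open Literature.Analysis.FunctionSpaces.Torus
open Literature.Analysis.FunctionSpaces.Torus renaming partialDeriv → tPartialDeriv

namespace Literature.Analysis.FluidPDE

namespace Torus

namespace DEIJ

variable {d : Type*} [Fintype d] [DecidableEq d]

/-! ## Spatial derivatives and Hölder norms of a shear drift -/

section Drift

omit [Fintype d] in
/-- The planar lift of the drift: `y ↦ (b φ(y_q)) e_p`. [folklore] -/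
theorem lift_drift (p q : d) (P : ShearProfile) (b : ℝ) :
    lift (drift p q P b) = fun y : EuclideanSpace ℝ d => (b * P (y q)) • EuclideanSpace.single p (1 : ℝ) := by
  funext y
  rw [lift_apply, drift_apply, proj_apply, ShearProfile.onCircle_coe]

/-- The Fréchet derivative of the lifted drift: `v ↦ (b φ'(y_q) v_q) e_p`. [folklore] -/
theorem hasFDerivAt_lift_drift (p q : d) (P : ShearProfile) (b : ℝ) (y : EuclideanSpace ℝ d) :
    HasFDerivAt (lift (drift p q P b))
      (((b * deriv P (y q)) • (EuclideanSpace.proj q : EuclideanSpace ℝ d →L[ℝ] ℝ)).smulRight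
        (EuclideanSpace.single p (1 : ℝ))) y := by
  rw [lift_drift]
  have h1 : HasFDerivAt (fun y : EuclideanSpace ℝ d => y q) (EuclideanSpace.proj q : EuclideanSpace ℝ d →L[ℝ] ℝ) y :=
    (EuclideanSpace.proj q : EuclideanSpace ℝ d →L[ℝ] ℝ).hasFDerivAt
  have h2 : HasDerivAt P (deriv P (y q)) (y q) :=
    (P.contDiff.differentiable (by simp)).differentiableAt.hasDerivAt
  have hφ : HasFDerivAt (fun y : EuclideanSpace ℝ d => P (y q))
      (deriv P (y q) • (EuclideanSpace.proj q : EuclideanSpace ℝ d →L[ℝ] ℝ)) y :=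
    h2.comp_hasFDerivAt y h1
  have hb : HasFDerivAt (fun y : EuclideanSpace ℝ d => b * P (y q))
      ((b * deriv P (y q)) • (EuclideanSpace.proj q : EuclideanSpace ℝ d →L[ℝ] ℝ)) y := by
    have h := hφ.const_mul b
    rwa [← mul_smul] at h
  exact hb.smul_const _

/-- **Spatial derivatives of a shear drift**: `∂ᵢ (b φ(x_q) e_p) = δ_{iq} b φ'(x_q) e_p`.
[folklore] -/
theorem partialDeriv_drift (p q : d) (P : ShearProfile) (b : ℝ) (i : d) (x : UnitAddTorus d) :
    tPartialDeriv i (drift p q P b) x =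
      (if i = q then b * P.D.onCircle (x q) else 0) • EuclideanSpace.single p (1 : ℝ) := by
  obtain ⟨y, rfl⟩ := proj_surjective x
  have h1 : IsContDiff 1 (drift p q P b) := (isSmooth_drift p q P b).isContDiff (by simp)
  rw [partialDeriv_eq_fderiv_apply h1, ← fderiv_lift, (hasFDerivAt_lift_drift p q P b y).fderiv,
    ContinuousLinearMap.smulRight_apply, FunLike.coe_smul, Pi.smul_apply, proj_apply,
    ShearProfile.onCircle_coe, ShearProfile.D_apply]
  by_cases hi : i = q
  · subst hi
    simp
  · simp [hi]

/-- **Size of the spatial derivatives of a shear drift**: `‖∂ᵢ drift‖ ≤ |b| B` when `|φ'| ≤ B`.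
[folklore] -/
theorem norm_partialDeriv_drift_le (p q : d) {P : ShearProfile} {B : ℝ} (hB : ∀ t, |deriv P t| ≤ B)
    (b : ℝ) (i : d) (x : UnitAddTorus d) :
    ‖tPartialDeriv i (drift p q P b) x‖ ≤ |b| * B := by
  have hB0 : 0 ≤ B := (abs_nonneg _).trans (hB 0)
  rw [partialDeriv_drift, norm_smul, PiLp.norm_single, norm_one, mul_one, Real.norm_eq_abs]
  split_ifs with hi
  · rw [abs_mul]
    refine mul_le_mul_of_nonneg_left ?_ (abs_nonneg _)
    induction x q using QuotientAddGroup.induction_on with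
    | H t => rw [ShearProfile.onCircle_coe, ShearProfile.D_apply]; exact hB t
  · rw [abs_zero]; positivity

/-- **The `C^{0,r}` norm of a shear drift** (`r ≤ 1`): if `|φ| ≤ A` and `|φ'| ≤ B` then
`‖b φ(x_q) e_p‖_{C^{0,r}} ≤ |b|A + (√d · d |b| B)^r (2|b|A)^{1-r}` — sup norm plus the
interpolation `[f]_r ≤ Lip(f)^r (2 sup|f|)^{1-r}` (`Gluing.eBoundedHolderNorm_le_interp`). For a
profile of amplitude `A` and frequency `N` (`B = AN`) this is `≲ |b| A N^r`, the stagewise bound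
summed in [cite: DrivasEtAl2022, §3.3]. -/
theorem eBoundedHolderNorm_drift_le (p q : d) {P : ShearProfile} {A B : ℝ} (hA : ∀ t, |P t| ≤ A)
    (hB : ∀ t, |deriv P t| ≤ B) (b : ℝ) {r : ℝ≥0} (hr : r ≤ 1) :
    eBoundedHolderNorm r (drift p q P b) ≤
      ENNReal.ofReal (|b| * A + (Real.sqrt (Fintype.card d) * (Fintype.card d * (|b| * B))) ^ (r : ℝ) *
        (2 * (|b| * A)) ^ (1 - (r : ℝ))) := by
  have hA0 : 0 ≤ A := (abs_nonneg _).trans (hA 0)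
  have hB0 : 0 ≤ B := (abs_nonneg _).trans (hB 0)
  have h1 : IsContDiff 1 (drift p q P b) := (isSmooth_drift p q P b).isContDiff (by simp)
  exact Gluing.eBoundedHolderNorm_le_interp h1 hr (by positivity) (by positivity)
    (norm_drift_le p q hA b) (norm_partialDeriv_drift_le p q hB b)

/-- A smooth periodic profile is bounded: `|φ| ≤ A` for some `A` (maximum of `|φ|` over the
compact circle). [folklore] -/
theorem _root_.Literature.Analysis.FunctionSpaces.Torus.ShearProfile.exists_abs_le (P : ShearProfile) :
    ∃ A : ℝ, ∀ t, |P t| ≤ A := by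
  obtain ⟨z₀, -, hz₀⟩ := isCompact_univ.exists_isMaxOn univ_nonempty
    (P.continuous_onCircle.abs.continuousOn (s := (univ : Set UnitAddCircle)))
  refine ⟨|P.onCircle z₀|, fun t => ?_⟩
  have h := hz₀ (mem_univ (t : UnitAddCircle))
  simpa [ShearProfile.onCircle_coe] using h

omit [Fintype d] [DecidableEq d] in
/-- A shear drift is in every `C^{0,r}_b`, `r ≤ 1`. [folklore] -/
theorem memBoundedHolder_drift [Fintype d] [DecidableEq d] (p q : d) (P : ShearProfile) (b : ℝ)
    {r : ℝ≥0} (hr : r ≤ 1) : MemBoundedHolder r (drift p q P b) := by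
  obtain ⟨A, hA⟩ := P.exists_abs_le
  obtain ⟨B, hB⟩ := P.D.exists_abs_le
  exact (eBoundedHolderNorm_drift_le p q hA (fun t => by simpa using hB t) b hr).trans_lt ENNReal.ofReal_lt_top

/-- **The `C^{0,r}` norm of the drift of a stage profile** `y ↦ c S_ε(N y + ϑ)`
(`DEIJ.stageProfile`, `|profile| ≤ |c|`, `|profile'| ≤ |c| N`):
`‖drift‖_{C^{0,r}} ≤ |b||c| + (√d · d |b||c| N)^r (2|b||c|)^{1-r}`. [cite: DrivasEtAl2022, §3.3] -/
theorem eBoundedHolderNorm_drift_stageProfile_le (p q : d) {ε : ℝ} (hε : 0 < ε) (hε' : ε ≤ 1 / 16)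
    (N : ℕ) (c ϑ b : ℝ) {r : ℝ≥0} (hr : r ≤ 1) :
    eBoundedHolderNorm r (drift p q (stageProfile ε hε hε' N c ϑ) b) ≤
      ENNReal.ofReal (|b| * |c| + (Real.sqrt (Fintype.card d) * (Fintype.card d * (|b| * (|c| * N)))) ^ (r : ℝ) *
        (2 * (|b| * |c|)) ^ (1 - (r : ℝ))) :=
  eBoundedHolderNorm_drift_le p q (abs_stageProfile_le hε hε' N c ϑ) (abs_deriv_stageProfile_le hε hε' N c ϑ) b hr

end Drift

/-! ## Continuity in `C^{0,r}` on `[0,T)` and the `L¹_t C^{0,r}_x` criterion -/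

section Time

variable {Y : Type*} [NormedAddCommGroup Y] [NormedSpace ℝ Y]

/-- **`C^∞([0,T) × T^d) ⊆ C([0,T); C^{0,r}(T^d))` for `r < 1`.** A field jointly smooth on the
half-open slab `[0,T) × T^d` is continuous on `[0,T)` with values in `C^{0,r}_b`: localise the
compact-interval statement `BrueDeLellis2023.continuousInHolderOn_of_isSmoothSpaceTimeOn` to
`[0,b] ⊆ [0,T)` with `t₀ < b < T`. [folklore] -/
theorem continuousInHolderOn_Ico_of_isSmoothSpaceTimeOn {u : ℝ → UnitAddTorus d → Y} {T : ℝ}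
    (hu : Torus.IsSmoothSpaceTimeOn (Ico 0 T) u) {r : ℝ≥0} (hr : r < 1) :
    ContinuousInHolderOn (Ico 0 T) r u := by
  -- the compact pieces
  have hpiece : ∀ t₀ ∈ Ico (0 : ℝ) T, ∃ b, t₀ < b ∧ b < T ∧ ContinuousInHolderOn (Icc 0 b) r u := by
    intro t₀ ht₀
    refine ⟨(t₀ + T) / 2, by linarith [ht₀.2], by linarith [ht₀.2], ?_⟩
    have hb : (0 : ℝ) < (t₀ + T) / 2 := by linarith [ht₀.1, ht₀.2]
    exact BrueDeLellis2023.continuousInHolderOn_of_isSmoothSpaceTimeOn hb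
      (hu.mono (Icc_subset_Ico_right (by linarith [ht₀.2]))) hr
  refine ⟨fun t ht => ?_, fun t₀ ht₀ => ?_⟩
  · obtain ⟨b, htb, -, hcont⟩ := hpiece t ht
    exact hcont.1 t ⟨ht.1, htb.le⟩
  · obtain ⟨b, htb, hbT, hcont⟩ := hpiece t₀ ht₀
    have hlim := hcont.2 t₀ ⟨ht₀.1, htb.le⟩
    -- near `t₀`, `[0,T)` and `[0,b]` agree
    have hmem : Icc (0 : ℝ) b ∈ 𝓝[Ico 0 T] t₀ := by
      have h1 : Iic b ∈ 𝓝 t₀ := Iic_mem_nhds htb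
      filter_upwards [inter_mem_nhdsWithin (Ico (0 : ℝ) T) h1] with t ht
      exact ⟨ht.1.1, ht.2⟩
    exact hlim.mono_left (nhdsWithin_le_of_mem hmem)

omit [DecidableEq d] [NormedSpace ℝ Y] in
/-- **An `L¹_t C^{0,r}_x` criterion without measurability.** If every slice `u t`, `t ∈ S`
(`S` measurable), is in `C^{0,r}_b` with `‖u t‖_{C^{0,r}} ≤ h t`, and `‖h‖_{L¹(S)} < ∞`, then
`u ∈ L¹_t C^{0,r}_x` on `S` (`FunctionSpaces.MemLpHolder 1 r u S`). The `L¹_t` functional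
`eLpHolderNorm` is a lower integral, monotone under a.e. pointwise bounds with no measurability
hypothesis. [folklore] -/
theorem memLpHolder_one_of_bound {X : Type*} [PseudoEMetricSpace X] {u : ℝ → X → Y} {S : Set ℝ}
    (hS : MeasurableSet S) {r : ℝ≥0} {h : ℝ → ℝ}
    (hmem : ∀ t ∈ S, MemBoundedHolder r (u t))
    (hle : ∀ t ∈ S, boundedHolderNorm r (u t) ≤ h t)
    (hh : eLpNorm h 1 (volume.restrict S) < ∞) :
    MemLpHolder 1 r u S := by
  refine ⟨?_, ?_⟩
  · filter_upwards [ae_restrict_mem hS] with t ht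
    exact hmem t ht
  · have hbound : ∀ᵐ t ∂(volume.restrict S), ‖boundedHolderNorm r (u t)‖ ≤ h t := by
      filter_upwards [ae_restrict_mem hS] with t ht
      rw [Real.norm_of_nonneg (by unfold boundedHolderNorm; exact ENNReal.toReal_nonneg)]
      exact hle t ht
    calc eLpHolderNorm 1 r u S ≤ eLpNorm h 1 (volume.restrict S) := eLpNorm_mono_ae_real hbound
      _ < ⊤ := hh

omit [DecidableEq d] [NormedSpace ℝ Y] in
/-- The same criterion with an integrable dominating function. [folklore] -/
theorem memLpHolder_one_of_integrableOn {X : Type*} [PseudoEMetricSpace X] {u : ℝ → X → Y} {S : Set ℝ}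
    (hS : MeasurableSet S) {r : ℝ≥0} {h : ℝ → ℝ}
    (hmem : ∀ t ∈ S, MemBoundedHolder r (u t))
    (hle : ∀ t ∈ S, boundedHolderNorm r (u t) ≤ h t)
    (hh : IntegrableOn h S volume) :
    MemLpHolder 1 r u S :=
  memLpHolder_one_of_bound hS hmem hle (memLp_one_iff_integrable.2 hh).eLpNorm_lt_top

end Time

end DEIJ

end Torus

end Literature.Analysis.FluidPDE
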